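import Mathlib
import Summits.Ventures.PercRepro2.Independence
import Summits.Ventures.PercRepro2.Harris
import Summits.Ventures.PercRepro2.HCov
import Summits.Ventures.PercRepro2.CutVertexPaths
import Summits.Ventures.PercRepro2.CutOneFarConn

/-!
# One mark behind a cut vertex, II: THE ONE-FAR-MARK EQUIVALENCE (blind cell PercRepro2,
typer-1 g48)

S3 §12.2 ((G5) of proofs/CRUX-SUBCLAIMS.md) in the kernel: with `v` a cut vertex between `L` and
`Rt`, the mark `w ∈ L` and the other four marks in `Rt ∪ {v}`,

  `Gc p ends o a₁ a₂ a₃ b = Gc (rweights p r) (rends v w) o a₁ a₂ a₃ b`,  `r = P_p(w ↔ v by left edges)`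

(**`Gc_eq_reduced`**): the covariance form of `A ∪_v B` is that of `B` with the far mark
re-attached to `v` by a pendant edge of weight `r`; hence **`HCov_of_reduced`**: (HCOV) on `G`
follows from (HCOV) on the reduced pendant graph.  Proof: the law of `Ψ` (`CutOneFarConn.lean`)
is the product law `rweights` — the right cylinder and the left connection event depend on
disjoint edge sets (`prob_inter_eq_mul_of_dependsOn`, `prob_cylinder`) — and `Ψ` transports
connectivity between the marks (`conn_marks_iff`), so `Gc_transport_marks'` applies.
-/

namespace Summit.Ventures.PercRepro2

open CovForm CutVertexM9

namespace CutOneFar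

/-! ## The law of `Ψ` is the product law of the reduced weights -/

section Law

variable {V : Type*} {E : Type*} [Fintype E] [DecidableEq E] {R : Type*} [Field R]
variable (ends : E → Sym2 V) (side : E → Bool) (v w : V)

/-- The left connection probability: `w` reaches `v` by left edges. -/
noncomputable def leftProb (p : E → R) : R :=
  prob p {ω | Conn ends (CutVertexM9.restrict side true ω) w v}

/-- The reduced weights: the right weights, and `r` on the pendant edge. -/
noncomputable def rweights (p : E → R) (r : R) : REdge side → R
  | Sum.inl e => p e.1
  | Sum.inr _ => r

omit [Fintype E] [DecidableEq E] in
/-- The reduced weights are admissible when `p` is and `r ∈ [0, 1]`. -/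
lemma isProbVec_rweights [LinearOrder R] [IsStrictOrderedRing R] {p : E → R} (hp : IsProbVec p)
    {r : R} (hr0 : 0 ≤ r) (hr1 : r ≤ 1) : IsProbVec (rweights side p r) where
  nonneg := by
    rintro (e | e)
    · exact hp.nonneg e.1
    · exact hr0
  le_one := by
    rintro (e | e)
    · exact hp.le_one e.1
    · exact hr1

/-- The left connection probability is admissible. -/
lemma isProbVec_rweights_leftProb [LinearOrder R] [IsStrictOrderedRing R] {p : E → R}
    (hp : IsProbVec p) : IsProbVec (rweights side p (leftProb ends side v w p)) :=
  isProbVec_rweights side hp (prob_nonneg hp _) (prob_le_one hp _)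

/-- The right cylinder of a reduced configuration: the right edges in the states of `σ'`. -/
def rightCyl (σ' : Config (REdge side)) : Set (Config E) :=
  {ω | ∀ e : {e : E // side e = false}, ω e.1 = σ' (Sum.inl e)}

open scoped Classical in
/-- The left event of a reduced configuration: the left connection in the state of the pendant
edge. -/
def leftEvt (σ' : Config (REdge side)) : Set (Config E) :=
  {ω | decide (Conn ends (CutVertexM9.restrict side true ω) w v) = σ' (Sum.inr ())}

omit [Fintype E] [DecidableEq E] in
/-- The fibre of `Ψ` is the right cylinder intersected with the left event. -/
lemma fibre_eq (σ' : Config (REdge side)) :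
    {ω : Config E | Ψ ends side v w ω = σ'} = rightCyl side σ' ∩ leftEvt ends side v w σ' := by
  ext ω
  simp only [Set.mem_setOf_eq, Set.mem_inter_iff, rightCyl, leftEvt]
  constructor
  · intro h
    exact ⟨fun e => by rw [← h]; rfl, by rw [← h]; rfl⟩
  · rintro ⟨h1, h2⟩
    funext e'
    rcases e' with e | e
    · exact h1 e
    · exact h2

omit [Fintype E] [DecidableEq E] in
/-- The right cylinder is determined by the right edges. -/
lemma dependsOn_rightCyl (σ' : Config (REdge side)) :
    DependsOn (· ∈ rightCyl side σ') {e | side e = false} := by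
  intro ω ω' h
  simp only [rightCyl, Set.mem_setOf_eq]
  exact propext ⟨fun hω e => by rw [← h e.1 e.2]; exact hω e,
    fun hω e => by rw [h e.1 e.2]; exact hω e⟩

omit [Fintype E] [DecidableEq E] in
/-- The left event is determined by the left edges. -/
lemma dependsOn_leftEvt (σ' : Config (REdge side)) :
    DependsOn (· ∈ leftEvt ends side v w σ') {e | side e = true} := by
  intro ω ω' h
  simp only [leftEvt, Set.mem_setOf_eq]
  rw [restrict_eq_of_agree (b := true) h]

/-- The probability of the right cylinder is the product of the right edge factors. -/
lemma prob_rightCyl (p : E → R) (σ' : Config (REdge side)) :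
    prob p (rightCyl side σ') =
      ∏ e : {e : E // side e = false}, edgeFactor (p e.1) (σ' (Sum.inl e)) := by
  classical
  let σR : Config E := fun e => if h : side e = false then σ' (Sum.inl ⟨e, h⟩) else false
  have hcyl : rightCyl side σ' = cylinder (Finset.univ.filter fun e => side e = false) σR := by
    ext ω
    simp only [rightCyl, Set.mem_setOf_eq, mem_cylinder, Finset.mem_filter, Finset.mem_univ,
      true_and, σR]
    constructor
    · intro h e he
      rw [dif_pos he]
      exact h ⟨e, he⟩
    · intro h e
      have := h e.1 e.2
      rwa [dif_pos e.2] at this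
  rw [hcyl, prob_cylinder, Finset.prod_subtype (p := fun e => side e = false)
    (Finset.univ.filter fun e => side e = false) (fun e => by simp)]
  refine Finset.prod_congr rfl fun e _ => ?_
  simp only [σR, dif_pos e.2]

/-- The probability of the left event is the edge factor of the left connection probability. -/
lemma prob_leftEvt (p : E → R) (σ' : Config (REdge side)) :
    prob p (leftEvt ends side v w σ') = edgeFactor (leftProb ends side v w p) (σ' (Sum.inr ())) := by
  cases hσ : σ' (Sum.inr ())
  · have : leftEvt ends side v w σ' =
        {ω | Conn ends (CutVertexM9.restrict side true ω) w v}ᶜ := by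
      ext ω
      simp [leftEvt, hσ]
    rw [this, prob_compl]
    rfl
  · have : leftEvt ends side v w σ' = {ω | Conn ends (CutVertexM9.restrict side true ω) w v} := by
      ext ω
      simp [leftEvt, hσ]
    rw [this]
    rfl

omit [DecidableEq E] in
/-- The weight of a reduced configuration splits into the right product and the pendant factor. -/
lemma weight_rweights (p : E → R) (r : R) (σ' : Config (REdge side)) :
    weight (rweights side p r) σ' =
      (∏ e : {e : E // side e = false}, edgeFactor (p e.1) (σ' (Sum.inl e))) *
        edgeFactor r (σ' (Sum.inr ())) := by
  rw [weight, Fintype.prod_sum_type]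
  congr 1
  rw [Fintype.prod_unique]
  rfl

/-- **The law of `Ψ` at a point**: the fibre of `σ'` has the product weight. -/
theorem prob_fibre_eq (p : E → R) (σ' : Config (REdge side)) :
    prob p {ω | Ψ ends side v w ω = σ'} = weight (rweights side p (leftProb ends side v w p)) σ' := by
  have hdisj : Disjoint {e | side e = false} {e | side e = true} := by
    rw [Set.disjoint_left]
    intro e he he'
    simp only [Set.mem_setOf_eq] at he he'
    rw [he] at he'
    exact Bool.false_ne_true he'
  rw [fibre_eq, prob_inter_eq_mul_of_dependsOn p hdisj (dependsOn_rightCyl side σ')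
    (dependsOn_leftEvt ends side v w σ'), prob_rightCyl, prob_leftEvt, weight_rweights]

/-- **Pushforward**: the probability of a reduced event under `Ψ` is its probability at the
reduced weights. -/
theorem prob_Ψ_preimage (p : E → R) (A : Set (Config (REdge side))) :
    prob p (Ψ ends side v w ⁻¹' A) = prob (rweights side p (leftProb ends side v w p)) A := by
  classical
  calc prob p (Ψ ends side v w ⁻¹' A)
      = ∑ ω, (Ψ ends side v w ⁻¹' A).indicator (weight p) ω := rfl
    _ = ∑ σ', ∑ ω ∈ Finset.univ.filter (fun ω => Ψ ends side v w ω = σ'),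
          (Ψ ends side v w ⁻¹' A).indicator (weight p) ω :=
        (Finset.sum_fiberwise Finset.univ (Ψ ends side v w) _).symm
    _ = ∑ σ', A.indicator (fun σ' => prob p {ω | Ψ ends side v w ω = σ'}) σ' := by
        refine Finset.sum_congr rfl fun σ' _ => ?_
        by_cases hA : σ' ∈ A
        · rw [Set.indicator_of_mem hA]
          unfold prob
          rw [Finset.sum_filter]
          refine Finset.sum_congr rfl fun ω _ => ?_
          by_cases hω : Ψ ends side v w ω = σ'
          · rw [if_pos hω, Set.indicator_of_mem (show ω ∈ {ω | Ψ ends side v w ω = σ'} from hω),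
              Set.indicator_of_mem (show ω ∈ Ψ ends side v w ⁻¹' A from by
                rw [Set.mem_preimage, hω]; exact hA)]
          · rw [if_neg hω,
              Set.indicator_of_notMem (show ω ∉ {ω | Ψ ends side v w ω = σ'} from hω)]
        · rw [Set.indicator_of_notMem hA]
          refine Finset.sum_eq_zero fun ω hω => ?_
          rw [Finset.mem_filter] at hω
          rw [Set.indicator_of_notMem]
          rw [Set.mem_preimage, hω.2]
          exact hA
    _ = ∑ σ', A.indicator (weight (rweights side p (leftProb ends side v w p))) σ' := by
        refine Finset.sum_congr rfl fun σ' _ => ?_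
        by_cases hA : σ' ∈ A
        · rw [Set.indicator_of_mem hA, Set.indicator_of_mem hA, prob_fibre_eq]
        · rw [Set.indicator_of_notMem hA, Set.indicator_of_notMem hA]
    _ = prob (rweights side p (leftProb ends side v w p)) A := rfl

end Law

/-! ## The one-far-mark equivalence -/

section Theorem

variable {V : Type*} {E : Type*} [Fintype E] [DecidableEq E] {R : Type*} [Field R]
variable {ends : E → Sym2 V} {side : E → Bool} {L : Set V} {v : V} {Rt : Set V} {w : V}

/-- **THE ONE-FAR-MARK EQUIVALENCE** (S3 §12.2): with `v` a cut vertex, the mark `w` on the left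
and the other marks on the right (or at `v`), the covariance form of `G` is that of the reduced
graph — the right side with `w` re-attached to `v` by a pendant edge of weight `P(w ↔ v by left
edges)`. -/
theorem Gc_eq_reduced (h : CutVertex ends side L v Rt) (hw : w ∈ L) (p : E → R)
    (o a₁ a₂ a₃ b : V) (hM : ∀ m ∈ ({o, a₁, a₂, a₃, b} : Set V), m = w ∨ m ∈ Rt ∨ m = v) :
    Gc p ends o a₁ a₂ a₃ b =
      Gc (rweights side p (leftProb ends side v w p)) (rends ends side v w) o a₁ a₂ a₃ b :=
  (Gc_transport_marks' (fun A => (prob_Ψ_preimage ends side v w p A).symm) o a₁ a₂ a₃ b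
    (fun ω x hx z hz => conn_marks_iff h hw ω (hM x hx) (hM z hz))).symm

/-- **(HCOV) on `G` from (HCOV) on the reduced pendant graph.** -/
theorem HCov_of_reduced [LinearOrder R] (h : CutVertex ends side L v Rt) (hw : w ∈ L) (p : E → R)
    (o a₁ a₂ a₃ b : V) (hM : ∀ m ∈ ({o, a₁, a₂, a₃, b} : Set V), m = w ∨ m ∈ Rt ∨ m = v)
    (hred : HCov (rweights side p (leftProb ends side v w p)) (rends ends side v w) o a₁ a₂ a₃ b) :
    HCov p ends o a₁ a₂ a₃ b := by
  unfold HCov at hred ⊢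
  rw [Gc_eq_reduced h hw p o a₁ a₂ a₃ b hM]
  exact hred

end Theorem

end CutOneFar

end Summit.Ventures.PercRepro2
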